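import Summits.Parity.GeneralizedHardyLittlewood.Theses.LinnikGallagherMV
import Literature.NumberTheory.Sieve.GoldbachLinnikMeanSquareCrude

/-!
# Route `LinnikGallagherMV` — support `MeanSquareCrude` (stmt-Parity-20514)

The crude mean square on the whole circle — there is `C > 0` with
`∫₀¹ |A_N(α) G_L(α)|² dα ≤ (C + ε)·2N L²` eventually, `L = prLen N`, every `ε > 0` (Parseval + the
pair sieve uniform in the shift + Romanov's lemma) — is VERBATIM the tree theorem
`Literature.NumberTheory.Sieve.GoldbachLinnik.meanSquareCrude`
(`Literature/NumberTheory/Sieve/GoldbachLinnikMeanSquareCrude.lean`, p534510); this file closes the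
item by `exact`.  Honesty label of the route: a FORMALISATION floor rung (F-LGE) of Parity —
formalisation-first of Linnik 1953 / Gallagher 1975; no new mathematics, no value of `K`, never
distance-to-Goldbach.

References: J. Pintz, I. Z. Ruzsa, Acta Arith. 109 (2003) [PintzRuzsa2003]; D. R. Heath-Brown,
J.-C. Puchta, Asian J. Math. 6 (2002) [HeathbrownPuchta2002]; M. B. Nathanson, *Additive Number
Theory: The Classical Bases* (1996) §7 [Nathanson1996].
-/

namespace Summit.Parity.GeneralizedHardyLittlewood.Theorems

/-- **Support `MeanSquareCrude` PROVED** (item stmt-Parity-20514): there is `C > 0` such that for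
every `ε > 0`, eventually in `N`,
`∫_{[0,1]} ‖A_N(α) · G_{prLen N}(α)‖² dα ≤ (C + ε) · (2N · (prLen N)²)` — by the Literature theorem
`GoldbachLinnik.meanSquareCrude` (Parseval and the pair sieve with Romanov's lemma).
[cite: PintzRuzsa2003, §1; Nathanson1996, §7.6] -/
theorem linnikGallagherMV_meanSquareCrude_proof :
    Summit.Parity.GeneralizedHardyLittlewood.Theses.LinnikGallagherMV.MeanSquareCrude :=
  Literature.NumberTheory.Sieve.GoldbachLinnik.meanSquareCrude

end Summit.Parity.GeneralizedHardyLittlewood.Theorems
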